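import Literature.Geometry.Kaehler.ComplexTorusCorrespondenceCompositionAssoc
import Literature.Geometry.Kaehler.ComplexTorusCorrespondenceWeilFormula
import HarnessLib

/-!
# Conjugation of correspondences by the graph of an isogeny:
# `Z ↦ Γ_f ∘ Z ∘ ᵗΓ_f` is multiplicative and unital up to `deg f`, inverted by `W ↦ ᵗΓ_f ∘ W ∘ Γ_f` up to `(deg f)²`
# (Weil's formula, Kahn Prop. 2.22; Fulton, Prop. 16.1.1 and Cor. 16.1.1; Lange 2023, Cor. 1.1.16 (b))

Layer `Literature/Geometry/Kaehler`, namespace `Literature.Geometry.Kaehler.ComplexTorus`; lane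
`lit-hodgefound` (Track 2 foundations library), Layer A4, rows A4-50⁺ / A4-51⁺ (programme Q58 of
`run/shared/lean/pub/lit-hodgefound/SKELETON.md`; prover seat `lit-hodgefound-p07`, generation 11, leaf (xliii)).
The junction of leaf (xlii) `ComplexTorusCorrespondenceCompositionAssoc.lean` (associativity of Lange's
composition `corrComp`, Fulton Prop. 16.1.1 (a)), of A4-50's two-sided unit `[Δ]`
(`corrComp_cycleForm_diagonal`, `corrComp_cycleForm_diagonal_left`, Cor. 6.2.11) and A4-51's anti-involution
`corrTranspose` (`corrTranspose_corrComp_of_even`, `corrTranspose_corrTranspose`), with leaf (xxxviii)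
`ComplexTorusCorrespondenceWeilFormula.lean` (Weil's formula ON THE NOSE for p08's graph class
`G = [Γ_f] = (1_Y, f)_*[Y] ∈ H^{2g}(Y × X)` of a homomorphism `f = ρ(A) : Y → X` between complex tori of the
same dimension `g`: `ᵗG ∘ G = N · [Δ_Y]`, `G ∘ ᵗG = N · [Δ_X]`, `N = #Ker f` — `= deg f` for an isogeny, `0`
otherwise).

Sources, verbatim. B. Kahn, *Zeta and L-Functions of Varieties and Motives* (2020), §2.9.2 Prop. 2.22
[held text `book:kahn2020-zeta-l-functions-varieties-motives` p0031 L3–L7] (Weil): "`γ ∘ ᵗγ = d'(γ) Δ_{C'}`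
[…] `f_* ∘ f^* = deg(f) Δ_{C'}`". W. Fulton, *Intersection Theory* (2nd ed. 1998), §16.1 Prop. 16.1.1
[held text `book:fultonnd-intersection-theory` p0293 L20–L23]: "(a) `γ ∘ (β ∘ α) = (γ ∘ β) ∘ α`. (b)
`(β ∘ α)' = α' ∘ β'`, and `(α')' = α`"; Cor. 16.1.1 [p0295 L7]: "`A(X × X)` […] an associative ring with
unit `[Δ_X]`, and with an involution". H. Lange, *Abelian Varieties over the Complex Numbers* (2023), §1.1.2
Cor. 1.1.16 (b) [galaxy `panama:512037411094592` p0021 L9–L10]: "An element in `End(X)` is an isogeny if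
and only if it is invertible in `End_ℚ(X)`" (with Prop. 1.1.15: the quasi-inverse `g`, `gf = e_X`).

The correspondence-ring reading of these facts, for the degree-`0` correspondences
`C(Y) = H^{2g}(Y × Y)`, `C(X) = H^{2g}(X × X)` (Fulton Remark 16.1 (i)) of two complex tori of dimension
`g` and a homomorphism `f : Y → X` with graph class `G` (`N = #Ker f`): Weil's formula says that `N⁻¹ ᵗG` is
a two-sided inverse of `G` (`f` an isogeny), and CONJUGATION `κ(Z) := G ∘ Z ∘ ᵗG : C(Y) → C(X)` satisfies
`κ(Z₂) ∘ κ(Z₁) = N · κ(Z₂ ∘ Z₁)`, `κ([Δ_Y]) = N · [Δ_X]`, `ᵗκ(Z) = κ(ᵗZ)`, and with the opposite conjugation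
`κ'(W) := ᵗG ∘ W ∘ G : C(X) → C(Y)`: `κ'(κ(Z)) = N² · Z`, `κ(κ'(W)) = N² · W` — so for an isogeny (`N = deg f
≠ 0`) `N⁻¹ κ` is an isomorphism of the unital `ℚ`-algebras (with involution) of cohomological
correspondences `C(Y)_ℚ ≅ C(X)_ℚ` with inverse `N⁻¹ κ'`: the correspondence rings of isogenous tori agree
after `⊗ ℚ` (the analogue for correspondences of "isogenies are the units of `End_ℚ(X)`", Cor. 1.1.16 (b)).
For a non-surjective `f` every identity degenerates correctly (`N = 0`).

Typing: all classes in the degree presentation `g + g` (`2 dim = g + g`), `G` over the positively oriented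
enumeration `e_Y` in the presentation `e : Fin ((g+g)+(g+g)) ≃ κ ⊕ ι`; `ᵗ` = `corrTranspose`, `∘` = `corrComp`
through the middle enumerations `e_Y` / `e_X` (on which it does not depend); `F`, `E` in one universe.

## Contents (theorems only; NO definition, NO named fact, net debt 0)

* §1 `corrComp_corrComp_corrTranspose_cycleForm_graph_cycleForm_graph_self` (`(Z ∘ ᵗG) ∘ G = N · Z`),
  `corrComp_cycleForm_graph_corrComp_corrTranspose_cycleForm_graph_self` (`G ∘ (ᵗG ∘ W) = N · W`),
  `corrComp_corrTranspose_cycleForm_graph_corrComp_cycleForm_graph_self` (`ᵗG ∘ (G ∘ Z) = N · Z`),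
  `corrComp_corrComp_cycleForm_graph_corrTranspose_cycleForm_graph_self` (`(W ∘ G) ∘ ᵗG = N · W`) — Weil's formula
  as CANCELLATION rules (associativity + unit), for correspondences `Z`, `W` to / from an arbitrary third torus `T`.
* §2 **`conj_mul`**: `κ(Z₂) ∘ κ(Z₁) = N · κ(Z₂ ∘ Z₁)`; **`conj_one`**: `κ([Δ_Y]) = N · [Δ_X]`;
  `corrTranspose_conj`: `ᵗ(κ Z) = κ(ᵗZ)`.
* §3 **`conjInv_conj`**: `κ'(κ(Z)) = N² · Z`; **`conj_conjInv`**: `κ(κ'(W)) = N² · W`.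
  (`κ`, `κ'` are spelled out as `corrComp` expressions; the names abbreviate the docstrings only.)

## References

* [Kahn2020] B. Kahn, *Zeta and L-Functions of Varieties and Motives*, LMS LN 462, CUP (2020), §2.9.2 Prop. 2.22.
* [Fulton1998] W. Fulton, *Intersection Theory*, 2nd ed., Springer (1998), §16.1 Prop. 16.1.1 (a), (b),
  Cor. 16.1.1, Remark 16.1 (i) (pp. 293–295).
* [Lange2023AbelianVarietiesComplex] H. Lange, *Abelian Varieties over the Complex Numbers* (2023), §1.1.2
  Prop. 1.1.15, Cor. 1.1.16 (b) (p. 22); §6.2.2 Prop. 6.2.10, Cor. 6.2.11.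
-/

noncomputable section

open scoped Manifold Matrix
open Set Function Module

namespace Literature.Geometry.Kaehler

namespace ComplexTorus

universe u

variable {κ ι : Type*} [Fintype κ] [Fintype ι] [DecidableEq κ] [DecidableEq ι] {F E : Type u}
  [NormedAddCommGroup F] [NormedSpace ℂ F] [NormedAddCommGroup E] [NormedSpace ℂ E]
  (Ψ : (κ → ℝ) ≃L[ℝ] F) (Φ : (ι → ℝ) ≃L[ℝ] E) {g : ℕ}
  (e_Y : Fin (g + g) ≃ κ) (he_Y : orientationSign Ψ e_Y = 1) {L : F →L[ℂ] E} {A : Matrix ι κ ℤ}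
  (hA : ∀ x : κ → ℝ, Φ ((A.map (Int.cast : ℤ → ℝ)).mulVec x) = L (Ψ x))
  (e_X : Fin (g + g) ≃ ι) (he_X : orientationSign Φ e_X = 1) (e : Fin ((g + g) + (g + g)) ≃ κ ⊕ ι)
  (eΔY : Fin ((g + g) + (g + g)) ≃ κ ⊕ κ) (eΔX : Fin ((g + g) + (g + g)) ≃ ι ⊕ ι)

/-! ### §0 Weil's formula in the presentation `g + g` (auxiliary enumerations chosen) -/

include hA he_X in
/-- Weil §3 with the auxiliary positively oriented enumerations of `Λ_X ⊕ Λ_Y`, `Λ_X ⊕ Λ_X` chosen: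
`G ∘ ᵗG = N · [Δ_X]`. [cite: Kahn2020, §2.9.2 Prop. 2.22] -/
private theorem weil_right_aux :
    corrComp Φ Ψ Φ e_Y ((SubtorusFrame.graph Ψ Φ e_Y he_Y L A hA).cycleForm e)
        (corrTranspose ((SubtorusFrame.graph Ψ Φ e_Y he_Y L A hA).cycleForm e)) =
      (Nat.card (mapMatrixHom Ψ Φ A).ker : ℂ) • (SubtorusFrame.diagonal Φ e_X he_X).cycleForm eΔX := by
  obtain ⟨e_s, hs⟩ := exists_orientationSign_eq_one (prodPeriod Φ Ψ) (e.trans (Equiv.sumComm κ ι))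
  obtain ⟨e_t, ht⟩ := exists_orientationSign_eq_one (prodPeriod Φ Φ) eΔX
  exact corrComp_cycleForm_graph_corrTranspose_cycleForm_graph_self Ψ Φ e_Y he_Y hA e_X he_X e e eΔX e_s hs
    e_t ht

/-! ### §1 Weil's formula as cancellation rules (third torus `T = E₃/Λ₃` arbitrary) -/

section Cancel

variable {ι₃ : Type*} [Fintype ι₃] [DecidableEq ι₃] {E₃ : Type*} [NormedAddCommGroup E₃] [NormedSpace ℂ E₃]
  (Θ : (ι₃ → ℝ) ≃L[ℝ] E₃) {l₃ d₃ : ℕ}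

include hA in
/-- **`(Z ∘ ᵗG) ∘ G = N · Z`** for every `Z ∈ H^{g+l₃}(Y × T)` (`ᵗG ∘ G = N · [Δ_Y]`, associativity, right
unit): right cancellation of `G`. [cite: Kahn2020, §2.9.2 Prop. 2.22] [cite: Fulton1998, §16.1 Prop. 16.1.1 (a) and Cor. 16.1.1] -/
theorem corrComp_corrComp_corrTranspose_cycleForm_graph_cycleForm_graph_self (Z : (F × E₃) [⋀^Fin (g + l₃)]→L[ℝ] ℂ) :
    corrComp Ψ Φ Θ e_X (corrComp Φ Ψ Θ e_Y Z (corrTranspose ((SubtorusFrame.graph Ψ Φ e_Y he_Y L A hA).cycleForm e)))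
        ((SubtorusFrame.graph Ψ Φ e_Y he_Y L A hA).cycleForm e) =
      (Nat.card (mapMatrixHom Ψ Φ A).ker : ℂ) • Z := by
  rw [← corrComp_assoc,
    corrComp_corrTranspose_cycleForm_graph_cycleForm_graph_self Ψ Φ e_Y he_Y hA e_X e e (finSumFinEquiv.symm.trans (e_Y.sumCongr e_Y)),
    corrComp_smul_right, corrComp_cycleForm_diagonal]

include hA he_X in
/-- **`G ∘ (ᵗG ∘ W) = N · W`** for every `W ∈ H^{d₃+g}(T × X)` (`G ∘ ᵗG = N · [Δ_X]`, associativity, left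
unit): left cancellation of `ᵗG`. [cite: Kahn2020, §2.9.2 Prop. 2.22] [cite: Fulton1998, §16.1 Prop. 16.1.1 (a) and Cor. 16.1.1] -/
theorem corrComp_cycleForm_graph_corrComp_corrTranspose_cycleForm_graph_self (W : (E₃ × E) [⋀^Fin (d₃ + g)]→L[ℝ] ℂ) :
    corrComp Θ Ψ Φ e_Y ((SubtorusFrame.graph Ψ Φ e_Y he_Y L A hA).cycleForm e)
        (corrComp Θ Φ Ψ e_X (corrTranspose ((SubtorusFrame.graph Ψ Φ e_Y he_Y L A hA).cycleForm e)) W) =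
      (Nat.card (mapMatrixHom Ψ Φ A).ker : ℂ) • W := by
  rw [corrComp_assoc, weil_right_aux Ψ Φ e_Y he_Y hA e_X he_X e (finSumFinEquiv.symm.trans (e_X.sumCongr e_X)), corrComp_smul_left,
    corrComp_cycleForm_diagonal_left]

include hA in
/-- **`ᵗG ∘ (G ∘ Z) = N · Z`** for every `Z ∈ H^{d₃+g}(T × Y)`: left cancellation of `G`.
[cite: Kahn2020, §2.9.2 Prop. 2.22] [cite: Fulton1998, §16.1 Prop. 16.1.1 (a) and Cor. 16.1.1] -/
theorem corrComp_corrTranspose_cycleForm_graph_corrComp_cycleForm_graph_self (Z : (E₃ × F) [⋀^Fin (d₃ + g)]→L[ℝ] ℂ) :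
    corrComp Θ Φ Ψ e_X (corrTranspose ((SubtorusFrame.graph Ψ Φ e_Y he_Y L A hA).cycleForm e))
        (corrComp Θ Ψ Φ e_Y ((SubtorusFrame.graph Ψ Φ e_Y he_Y L A hA).cycleForm e) Z) =
      (Nat.card (mapMatrixHom Ψ Φ A).ker : ℂ) • Z := by
  rw [corrComp_assoc,
    corrComp_corrTranspose_cycleForm_graph_cycleForm_graph_self Ψ Φ e_Y he_Y hA e_X e e (finSumFinEquiv.symm.trans (e_Y.sumCongr e_Y)),
    corrComp_smul_left, corrComp_cycleForm_diagonal_left]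

include hA he_X in
/-- **`(W ∘ G) ∘ ᵗG = N · W`** for every `W ∈ H^{g+l₃}(X × T)`: right cancellation of `ᵗG`.
[cite: Kahn2020, §2.9.2 Prop. 2.22] [cite: Fulton1998, §16.1 Prop. 16.1.1 (a) and Cor. 16.1.1] -/
theorem corrComp_corrComp_cycleForm_graph_corrTranspose_cycleForm_graph_self (W : (E × E₃) [⋀^Fin (g + l₃)]→L[ℝ] ℂ) :
    corrComp Φ Ψ Θ e_Y (corrComp Ψ Φ Θ e_X W ((SubtorusFrame.graph Ψ Φ e_Y he_Y L A hA).cycleForm e))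
        (corrTranspose ((SubtorusFrame.graph Ψ Φ e_Y he_Y L A hA).cycleForm e)) =
      (Nat.card (mapMatrixHom Ψ Φ A).ker : ℂ) • W := by
  rw [← corrComp_assoc, weil_right_aux Ψ Φ e_Y he_Y hA e_X he_X e (finSumFinEquiv.symm.trans (e_X.sumCongr e_X)), corrComp_smul_right,
    corrComp_cycleForm_diagonal]

end Cancel

/-! ### §2 Conjugation `κ(Z) = G ∘ Z ∘ ᵗG` is multiplicative and unital up to `N`, and commutes with `ᵗ` -/

include hA in
/-- **`κ(Z₂) ∘ κ(Z₁) = N · κ(Z₂ ∘ Z₁)`** for `κ(Z) := G ∘ (Z ∘ ᵗG) : H^{2g}(Y × Y) → H^{2g}(X × X)`: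
conjugation by the graph class of `f` is multiplicative up to `N = #Ker f` (`= deg f` for an isogeny; for an
isogeny `N⁻¹ κ` is a ring homomorphism `C(Y)_ℚ → C(X)_ℚ`). [cite: Kahn2020, §2.9.2 Prop. 2.22]
[cite: Fulton1998, §16.1 Prop. 16.1.1 (a) and Cor. 16.1.1] [cite: Lange2023AbelianVarietiesComplex, §1.1.2 Cor. 1.1.16 (b)] -/
theorem conj_mul (Z₁ Z₂ : (F × F) [⋀^Fin (g + g)]→L[ℝ] ℂ) :
    corrComp Φ Φ Φ e_X
        (corrComp Φ Ψ Φ e_Y ((SubtorusFrame.graph Ψ Φ e_Y he_Y L A hA).cycleForm e)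
          (corrComp Φ Ψ Ψ e_Y Z₂ (corrTranspose ((SubtorusFrame.graph Ψ Φ e_Y he_Y L A hA).cycleForm e))))
        (corrComp Φ Ψ Φ e_Y ((SubtorusFrame.graph Ψ Φ e_Y he_Y L A hA).cycleForm e)
          (corrComp Φ Ψ Ψ e_Y Z₁ (corrTranspose ((SubtorusFrame.graph Ψ Φ e_Y he_Y L A hA).cycleForm e)))) =
      (Nat.card (mapMatrixHom Ψ Φ A).ker : ℂ) •
        corrComp Φ Ψ Φ e_Y ((SubtorusFrame.graph Ψ Φ e_Y he_Y L A hA).cycleForm e)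
          (corrComp Φ Ψ Ψ e_Y (corrComp Ψ Ψ Ψ e_Y Z₂ Z₁)
            (corrTranspose ((SubtorusFrame.graph Ψ Φ e_Y he_Y L A hA).cycleForm e))) := by
  -- `(G ∘ V₂) ∘ (G ∘ V₁) = G ∘ (V₂ ∘ (G ∘ V₁))`, `V₂ ∘ (G ∘ V₁) = Z₂ ∘ (ᵗG ∘ (G ∘ V₁)) = N · Z₂ ∘ V₁`
  rw [← corrComp_assoc Φ Φ Ψ Φ e_X e_Y, ← corrComp_assoc Φ Φ Ψ Ψ e_X e_Y, corrComp_assoc Φ Ψ Φ Ψ e_Y e_X,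
    corrComp_corrTranspose_cycleForm_graph_cycleForm_graph_self Ψ Φ e_Y he_Y hA e_X e e (finSumFinEquiv.symm.trans (e_Y.sumCongr e_Y)),
    corrComp_smul_left, corrComp_cycleForm_diagonal_left, corrComp_smul_right, corrComp_smul_right,
    corrComp_assoc Φ Ψ Ψ Ψ e_Y e_Y]

include hA he_X in
/-- **`κ([Δ_Y]) = G ∘ ([Δ_Y] ∘ ᵗG) = N · [Δ_X]`**: conjugation is unital up to `N` (left unit, then Weil's
`G ∘ ᵗG = N · [Δ_X]`). [cite: Kahn2020, §2.9.2 Prop. 2.22] [cite: Lange2023AbelianVarietiesComplex, §6.2.2 Cor. 6.2.11] -/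
theorem conj_one :
    corrComp Φ Ψ Φ e_Y ((SubtorusFrame.graph Ψ Φ e_Y he_Y L A hA).cycleForm e)
        (corrComp Φ Ψ Ψ e_Y ((SubtorusFrame.diagonal Ψ e_Y he_Y).cycleForm eΔY)
          (corrTranspose ((SubtorusFrame.graph Ψ Φ e_Y he_Y L A hA).cycleForm e))) =
      (Nat.card (mapMatrixHom Ψ Φ A).ker : ℂ) • (SubtorusFrame.diagonal Φ e_X he_X).cycleForm eΔX := by
  rw [corrComp_cycleForm_diagonal_left, weil_right_aux Ψ Φ e_Y he_Y hA e_X he_X e eΔX]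

include hA in
/-- **`ᵗ(κ Z) = κ(ᵗZ)`**: conjugation commutes with the involution (`ᵗ(β ∘ α) = ᵗα ∘ ᵗβ` for classes of
even degree, `ᵗᵗG = G`). [cite: Fulton1998, §16.1 Prop. 16.1.1 (b) and Cor. 16.1.1] -/
theorem corrTranspose_conj (Z : (F × F) [⋀^Fin (g + g)]→L[ℝ] ℂ) :
    corrTranspose (corrComp Φ Ψ Φ e_Y ((SubtorusFrame.graph Ψ Φ e_Y he_Y L A hA).cycleForm e)
        (corrComp Φ Ψ Ψ e_Y Z (corrTranspose ((SubtorusFrame.graph Ψ Φ e_Y he_Y L A hA).cycleForm e)))) =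
      corrComp Φ Ψ Φ e_Y ((SubtorusFrame.graph Ψ Φ e_Y he_Y L A hA).cycleForm e)
        (corrComp Φ Ψ Ψ e_Y (corrTranspose Z)
          (corrTranspose ((SubtorusFrame.graph Ψ Φ e_Y he_Y L A hA).cycleForm e))) := by
  rw [corrTranspose_corrComp_of_even Φ Ψ Φ e_Y e_Y _ _ (Or.inl ⟨g, rfl⟩),
    corrTranspose_corrComp_of_even Φ Ψ Ψ e_Y e_Y _ _ (Or.inl ⟨g, rfl⟩), corrTranspose_corrTranspose, corrComp_assoc]

/-! ### §3 The opposite conjugation `κ'(W) = ᵗG ∘ W ∘ G` inverts `κ` up to `N²` -/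

include hA in
/-- **`κ'(κ(Z)) = ᵗG ∘ ((G ∘ (Z ∘ ᵗG)) ∘ G) = N² · Z`**: for an isogeny, `N⁻¹ κ'` is a left inverse of
`N⁻¹ κ` (`ᵗG ∘ G = N · [Δ_Y]` twice). [cite: Kahn2020, §2.9.2 Prop. 2.22] [cite: Fulton1998, §16.1 Prop. 16.1.1 (a)]
[cite: Lange2023AbelianVarietiesComplex, §1.1.2 Prop. 1.1.15 and Cor. 1.1.16 (b)] -/
theorem conjInv_conj (Z : (F × F) [⋀^Fin (g + g)]→L[ℝ] ℂ) :
    corrComp Ψ Φ Ψ e_X (corrTranspose ((SubtorusFrame.graph Ψ Φ e_Y he_Y L A hA).cycleForm e))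
        (corrComp Ψ Φ Φ e_X
          (corrComp Φ Ψ Φ e_Y ((SubtorusFrame.graph Ψ Φ e_Y he_Y L A hA).cycleForm e)
            (corrComp Φ Ψ Ψ e_Y Z (corrTranspose ((SubtorusFrame.graph Ψ Φ e_Y he_Y L A hA).cycleForm e))))
          ((SubtorusFrame.graph Ψ Φ e_Y he_Y L A hA).cycleForm e)) =
      ((Nat.card (mapMatrixHom Ψ Φ A).ker : ℂ) ^ 2) • Z := by
  rw [← corrComp_assoc Ψ Φ Ψ Φ e_X e_Y,
    corrComp_corrComp_corrTranspose_cycleForm_graph_cycleForm_graph_self Ψ Φ e_Y he_Y hA e_X e, corrComp_smul_right,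
    corrComp_smul_right, corrComp_corrTranspose_cycleForm_graph_corrComp_cycleForm_graph_self Ψ Φ e_Y he_Y hA e_X e,
    smul_smul, sq]

include hA he_X in
/-- **`κ(κ'(W)) = G ∘ ((ᵗG ∘ (W ∘ G)) ∘ ᵗG) = N² · W`**: for an isogeny, `N⁻¹ κ'` is a right inverse of
`N⁻¹ κ` (`G ∘ ᵗG = N · [Δ_X]` twice) — so `N⁻¹ κ : C(Y)_ℚ → C(X)_ℚ` is a bijection, an isomorphism of the
unital `ℚ`-algebras (with involution) of degree-`0` cohomological correspondences of two isogenous tori.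
[cite: Kahn2020, §2.9.2 Prop. 2.22] [cite: Fulton1998, §16.1 Prop. 16.1.1 (a) and Cor. 16.1.1]
[cite: Lange2023AbelianVarietiesComplex, §1.1.2 Prop. 1.1.15 and Cor. 1.1.16 (b)] -/
theorem conj_conjInv (W : (E × E) [⋀^Fin (g + g)]→L[ℝ] ℂ) :
    corrComp Φ Ψ Φ e_Y ((SubtorusFrame.graph Ψ Φ e_Y he_Y L A hA).cycleForm e)
        (corrComp Φ Ψ Ψ e_Y
          (corrComp Ψ Φ Ψ e_X (corrTranspose ((SubtorusFrame.graph Ψ Φ e_Y he_Y L A hA).cycleForm e))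
            (corrComp Ψ Φ Φ e_X W ((SubtorusFrame.graph Ψ Φ e_Y he_Y L A hA).cycleForm e)))
          (corrTranspose ((SubtorusFrame.graph Ψ Φ e_Y he_Y L A hA).cycleForm e))) =
      ((Nat.card (mapMatrixHom Ψ Φ A).ker : ℂ) ^ 2) • W := by
  rw [← corrComp_assoc Φ Ψ Φ Ψ e_Y e_X,
    corrComp_corrComp_cycleForm_graph_corrTranspose_cycleForm_graph_self Ψ Φ e_Y he_Y hA e_X he_X e, corrComp_smul_right,
    corrComp_smul_right, corrComp_cycleForm_graph_corrComp_corrTranspose_cycleForm_graph_self Ψ Φ e_Y he_Y hA e_X he_X e,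
    smul_smul, sq]

end ComplexTorus

end Literature.Geometry.Kaehler

end
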